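import Mathlib
import HarnessLib
import Literature.Barriers.ValiantsHypothesis.PartialDerivativesDetPerm
import Summits.ValiantsHypothesis.ValiantsHypothesis.Theorems.SummationBitsHomogeneousRung
import Summits.ValiantsHypothesis.ValiantsHypothesis.Theorems.ChowBorderDepth3ChowBorderBoundFanInTwoRung

/-!
# Route SummationBits — crux `RyserOptimalDepth3` (stmt-ValiantsHypothesis-7565), stub F

**Stub `stub_flatteningRegime`** of the line `registered` (birth "degree dial") of the crux
`Summit.ValiantsHypothesis.ValiantsHypothesis.Theses.SummationBits.RyserOptimalDepth3`:
the low-degree ("flattening") regime.  For every `t` there is `c` (namely `c = t + 1`) such that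
for all `n ≥ 1`, every affine depth-three expression `per_n = Σ_{i<r} Π_{j<D} ℓ_ij`
(`ℓ_ij ∈ ℂ[x_{11}, …, x_{nn}]` of total degree `≤ 1`) with `D ≤ n + t⌊log₂(n+2)⌋` satisfies
`2^n ≤ r (D+1) (n+2)^c`.

## Proof (method of partial derivatives at order `k = ⌊n/2⌋`)

* `StubFlatteningRegime.choose_sq_le` — the order-`k` partials of `Σ_{i<r} Π_{j<D} ℓ_ij` lie in the
  span of the `r · binom(D, D-k)` sub-products `Π_{j∈T} ℓ_ij`, `#T = D - k` (tree, PROVED: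
  `Summit.ValiantsHypothesis.SummationBits.iterPDeriv_prod_mem_span`), while those of `per_n` span
  exactly `binom(n,k)²` dimensions (tree, PROVED:
  `Literature.Barriers.ValiantsHypothesis.flatteningRank_perPoly`); hence
  `binom(n,k)² ≤ r · binom(D, D-k)`.  This is `homogeneousRung_proof` (item 7569) with the index
  type `Fin n` of the factors replaced by `Fin D`.
* Arithmetic: `binom(D, D-k) ≤ 2^s binom(n,k)` for `D ≤ n + s`
  (`StubFlatteningRegime.choose_add_le`, Pascal's rule `s` times and `binom(n,j) ≤ binom(n,⌊n/2⌋)`),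
  `2^(t⌊log₂(n+2)⌋) ≤ (n+2)^t`, and `2^n = Σ_m binom(n,m) ≤ (n+1) binom(n,⌊n/2⌋)` (tree, PROVED:
  `two_pow_le_succ_mul_choose_middle` of
  `Summit.ValiantsHypothesis.ValiantsHypothesis.Theorems.ChowBorderBound.FanInTwoRung`);
  so `binom(n,k) ≤ r 2^s ≤ r (n+2)^t` and `2^n ≤ (n+1) binom(n,k) ≤ r (D+1) (n+2)^(t+1)`.

Unconditional; the hypothesis `1 ≤ n` is not used.

## References

* [NisanWigderson1996] N. Nisan, A. Wigderson, *Lower bounds on arithmetic circuits via partial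
  derivatives*, Comput. Complexity 6 (1996/97), §3.
* [LandsbergGCT2017] J. M. Landsberg, *Geometry and Complexity Theory*, CUP 2017, Prop. 7.2.2.1.
-/

-- Sub = Summit layout; duplicated namespace component intended
set_option linter.dupNamespace false

namespace Summit.ValiantsHypothesis.ValiantsHypothesis.Theorems.SummationBitsRyserOptimalDepth3

open MvPolynomial
open Literature.Computability.AlgebraicComplexity
open Literature.Barriers.ValiantsHypothesis

namespace StubFlatteningRegime

/-- **The flattening count** (Nisan–Wigderson): if `per_n = Σ_{i<r} Π_{j<D} ℓ_ij` with affine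
`ℓ_ij`, then for every `k` the order-`k` partials of the right-hand side span at most
`r · binom(D, D-k)` dimensions, those of `per_n` exactly `binom(n,k)²`; hence
`binom(n,k)² ≤ r · binom(D, D-k)`. [cite: NisanWigderson1996, §3] -/
theorem choose_sq_le {n r D : ℕ} (k : ℕ) (ℓ : Fin r → Fin D → MvPolynomial (Fin n × Fin n) ℂ)
    (hℓ : ∀ i j, (ℓ i j).totalDegree ≤ 1) (hsum : (∑ i, ∏ j, ℓ i j) = perPoly (Fin n) ℂ) :
    n.choose k * n.choose k ≤ r * D.choose (D - k) := by
  classical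
  -- the `r · binom(D, D-k)` sub-products `Π_{j ∈ T} ℓ_ij`, `#T = D - k`
  let b : Fin r × {T : Finset (Fin D) // T.card = D - k} → MvPolynomial (Fin n × Fin n) ℂ :=
    fun p => ∏ j ∈ p.2.1, ℓ p.1 j
  -- the `k`-th order partials of `per_n = Σ Π ℓ` lie in their span
  have hle : Submodule.span ℂ (derivSet k (perPoly (Fin n) ℂ)) ≤
      Submodule.span ℂ (Set.range b) := by
    rw [Submodule.span_le]
    rintro _ ⟨l, hl, rfl⟩
    rw [← hsum, iterPDeriv_sum]
    refine Submodule.sum_mem _ fun i _ => ?_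
    have hmem := Summit.ValiantsHypothesis.SummationBits.iterPDeriv_prod_mem_span (ℓ i) (hℓ i) l
    refine Submodule.span_mono ?_ hmem
    rintro _ ⟨T, rfl⟩
    exact ⟨(i, ⟨T.1, by rw [T.2, Fintype.card_fin, hl]⟩), rfl⟩
  -- dimension count
  have hfin : Module.finrank ℂ (Submodule.span ℂ (derivSet k (perPoly (Fin n) ℂ))) =
      (n.choose k) ^ 2 := by
    rw [← shiftedPartialsRank_zero_eq ℂ k (perPoly (Fin n) ℂ), flatteningRank_perPoly ℂ n k]
  haveI : Module.Finite ℂ (Submodule.span ℂ (Set.range b)) :=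
    Module.Finite.span_of_finite ℂ (Set.finite_range b)
  have h1 : Module.finrank ℂ (Submodule.span ℂ (derivSet k (perPoly (Fin n) ℂ))) ≤
      Module.finrank ℂ (Submodule.span ℂ (Set.range b)) := Submodule.finrank_mono hle
  have h2 : Module.finrank ℂ (Submodule.span ℂ (Set.range b)) ≤
      Fintype.card (Fin r × {T : Finset (Fin D) // T.card = D - k}) := finrank_range_le_card b
  rw [Fintype.card_prod, Fintype.card_fin, Fintype.card_finset_len, Fintype.card_fin] at h2
  rw [← sq, ← hfin]
  exact h1.trans h2

/-- Pascal's rule `s` times: `binom(n+s, j) ≤ 2^s · binom(n, ⌊n/2⌋)` for every `j`. [folklore] -/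
theorem choose_add_le (n s j : ℕ) : (n + s).choose j ≤ 2 ^ s * n.choose (n / 2) := by
  induction s generalizing j with
  | zero => simpa using Nat.choose_le_middle j n
  | succ s ih =>
    cases j with
    | zero =>
      rw [Nat.choose_zero_right]
      exact Nat.mul_pos (Nat.two_pow_pos _) (Nat.choose_pos (Nat.div_le_self n 2))
    | succ j =>
      calc (n + (s + 1)).choose (j + 1) = (n + s).choose j + (n + s).choose (j + 1) := by
            rw [← add_assoc, Nat.choose_succ_succ']
        _ ≤ 2 ^ s * n.choose (n / 2) + 2 ^ s * n.choose (n / 2) := add_le_add (ih j) (ih (j + 1))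
        _ = 2 ^ (s + 1) * n.choose (n / 2) := by ring

/-- The loss of the flattening count at degree `D ≤ n + s`:
`binom(D, D - ⌊n/2⌋) ≤ 2^s binom(n, ⌊n/2⌋)` (for `D < ⌊n/2⌋` the left-hand side is
`binom(D, 0) = 1`). [folklore] -/
theorem choose_sub_half_le {n s D : ℕ} (hD : D ≤ n + s) :
    D.choose (D - n / 2) ≤ 2 ^ s * n.choose (n / 2) := by
  rcases Nat.lt_or_ge D (n / 2) with h | h
  · rw [Nat.sub_eq_zero_of_le h.le, Nat.choose_zero_right]
    exact Nat.mul_pos (Nat.two_pow_pos _) (Nat.choose_pos (Nat.div_le_self n 2))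
  · rw [Nat.choose_symm h]
    exact (Nat.choose_le_choose (n / 2) hD).trans (choose_add_le n s (n / 2))

/-- `2^(t⌊log₂(n+2)⌋) ≤ (n+2)^t`. [folklore] -/
theorem two_pow_mul_log_le (t n : ℕ) : 2 ^ (t * Nat.log 2 (n + 2)) ≤ (n + 2) ^ t := by
  rw [mul_comm, pow_mul]
  exact Nat.pow_le_pow_left (Nat.pow_log_le_self 2 (by omega)) t

end StubFlatteningRegime

open StubFlatteningRegime in
/-- **Stub F of crux stmt-ValiantsHypothesis-7565 (line `registered`) — FLATTENING REGIME**: for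
every `t` there is `c` (`= t + 1`) such that for all `n ≥ 1`, every affine depth-three expression
`per_n = Σ_{i<r} Π_{j<D} ℓ_ij` (`ℓ_ij` of total degree `≤ 1`) with `D ≤ n + t⌊log₂(n+2)⌋` has
`2^n ≤ r (D+1) (n+2)^c`.  Method of partial derivatives at order `⌊n/2⌋`:
`binom(n,⌊n/2⌋)² ≤ r · binom(D, D-⌊n/2⌋) ≤ r · 2^(t⌊log₂(n+2)⌋) binom(n,⌊n/2⌋)`, so
`2^n ≤ (n+1) binom(n,⌊n/2⌋) ≤ (n+1) r (n+2)^t`.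
[cite: NisanWigderson1996, §3] [cite: LandsbergGCT2017, Prop. 7.2.2.1] -/
theorem stub_flatteningRegime :
    ∀ t : ℕ, ∃ c : ℕ, ∀ n : ℕ, 1 ≤ n →
      ∀ (r D : ℕ) (ℓ : Fin r → Fin D → MvPolynomial (Fin n × Fin n) ℂ),
        (∀ i j, (ℓ i j).totalDegree ≤ 1) → (∑ i, ∏ j, ℓ i j) = perPoly (Fin n) ℂ →
          D ≤ n + t * Nat.log 2 (n + 2) → 2 ^ n ≤ r * (D + 1) * (n + 2) ^ c := by
  intro t
  refine ⟨t + 1, fun n _hn r D ℓ hℓ hsum hD => ?_⟩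
  have key := choose_sq_le (n / 2) ℓ hℓ hsum
  have hpos : 0 < n.choose (n / 2) := Nat.choose_pos (Nat.div_le_self n 2)
  -- `binom(n,k) ≤ r · 2^s`, `s = t⌊log₂(n+2)⌋`
  have hr : n.choose (n / 2) ≤ r * 2 ^ (t * Nat.log 2 (n + 2)) := by
    refine Nat.le_of_mul_le_mul_right ?_ hpos
    calc n.choose (n / 2) * n.choose (n / 2) ≤ r * D.choose (D - n / 2) := key
      _ ≤ r * (2 ^ (t * Nat.log 2 (n + 2)) * n.choose (n / 2)) :=
          Nat.mul_le_mul_left r (choose_sub_half_le hD)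
      _ = r * 2 ^ (t * Nat.log 2 (n + 2)) * n.choose (n / 2) := (mul_assoc _ _ _).symm
  calc 2 ^ n ≤ (n + 1) * n.choose (n / 2) :=
        ChowBorderBound.FanInTwoRung.two_pow_le_succ_mul_choose_middle n
    _ ≤ (n + 1) * (r * 2 ^ (t * Nat.log 2 (n + 2))) := Nat.mul_le_mul_left _ hr
    _ ≤ (n + 2) * (r * (n + 2) ^ t) :=
        Nat.mul_le_mul (Nat.le_succ _) (Nat.mul_le_mul_left r (two_pow_mul_log_le t n))
    _ = r * 1 * (n + 2) ^ (t + 1) := by ring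
    _ ≤ r * (D + 1) * (n + 2) ^ (t + 1) := by
        gcongr
        exact Nat.succ_le_succ (Nat.zero_le D)

end Summit.ValiantsHypothesis.ValiantsHypothesis.Theorems.SummationBitsRyserOptimalDepth3
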